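import Literature.Barriers.CriticalPhenomena.LongRangeTrivialityOnZ3HighTemperature
import Literature.Barriers.CriticalPhenomena.LongRangeTrivialityOnZ3LowTemperature
import Literature.Barriers.CriticalPhenomena.LaceExpansionXSpaceAsymptotics

/-!
# `0 < β_c < ∞` for the algebraically decaying reflection-positive Ising models on `ℤ^d`, `d ≥ 2`:
# discharge of `panis_criticalBeta_pos`

Sibling of `Literature/Barriers/CriticalPhenomena/LongRangeTrivialityOnZ3.lean` (barrier catalogue
D-0021, sub-problem `Ising3DConformalLimit`). It **discharges** the named fact
`Literature.Barriers.CriticalPhenomena.panis_criticalBeta_pos` — Panis, *Triviality of the scaling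
limits of critical Ising and `φ⁴` models with effective dimension at least four*, arXiv:2309.05797 =
Ann. Probab. 54 (2026), §1.2.1, p. 6: "then, `β_c := inf{β > 0, m*(β) > 0} ∈ (0,∞)`. The above
assumptions guarantee [Fisher 1967] that `β_c > 0` (in fact `β_c ≥ |J|⁻¹`), while Peierls'
celebrated argument yields the bound `β_c < ∞`" — for the couplings `J_{x,y} = C₀|x-y|₁^{-d-α}`,
`C₀, α > 0`, `d ≥ 2`, of Theorem 1.2:

`theorem panis_criticalBeta_pos_holds : panis_criticalBeta_pos`.

The tree's `β_c` is `sInf {β | 0 < β ∧ 0 < m*(β)}` (`LongRangeIsing.criticalBeta`, `sInf ∅ = 0`), so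
both halves of the printed `β_c ∈ (0,∞)` are needed:

* the set is non-empty: `m*(4/C₀) ≥ ½` (`LongRangeTrivialityOnZ3LowTemperature.half_le_magnetization`,
  Peierls' estimate of the tree through Griffiths' 1964 convexity argument), because
  `J_{x,y} = C₀` on nearest neighbours (`algebraicCoupling_eq_of_adj`);
* it is bounded below by `|J|⁻¹ > 0`, `|J| = ∑_y J_{0,y}` (assumption (A2); a `tsum`):
  Fisher's bound `LongRangeTrivialityOnZ3HighTemperature.one_le_mul_of_magnetization_pos`, the row
  sums over any finite volume being `≤ |J|` (`sum_algebraicCoupling_le_tsum`) since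
  `∑_{y∈ℤ^d} |y|₁^{-d-α} < ∞` (`summable_algebraicCoupling_zero`, from the lattice `p`-series
  `summable_jnorm_rpow_neg` of `LaceExpansionXSpaceAsymptotics` and `⟦y⟧ = |y|₂ ∨ 1 ≤ |y|₁` for `y ≠ 0`).

Recorded on the way: `β_c ≥ |J|⁻¹` (`inv_tsum_le_criticalBeta`, the printed Fisher bound)
and `β_c ≤ 4/C₀` (`criticalBeta_le`, Peierls).

## References

* R. Panis, arXiv:2309.05797 (2023) = Ann. Probab. 54 (2026), §1.2.1, (A2) and the display
  `β_c ∈ (0,∞)` [Panis2023Triviality] (held; read pp. 5–6).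
* M. E. Fisher, Phys. Rev. 162 (1967) 480–485; R. Peierls, Proc. Camb. Phil. Soc. 32 (1936) 477–481
  [Peierls1936] (as cited there).
* S. Friedli, Y. Velenik, *Statistical Mechanics of Lattice Systems*, CUP (2017), Thm. 3.25, §3.8.1
  [FriedliVelenik2017].
-/

noncomputable section

namespace Literature.Barriers.CriticalPhenomena

open Literature.Probability.LatticeModels Literature.Probability.Percolation Filter Topology Finset

namespace LongRangeIsing

variable {d : ℕ}

/-! ### The `ℓ¹` norm dominates `⟦·⟧ = |·|₂ ∨ 1` off the origin -/

/-- The `ℓ¹` norm as a real sum of absolute values. [folklore] -/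
theorem cast_l1Norm (y : Site d) : (l1Norm y : ℝ) = ∑ i, |((y i : ℤ) : ℝ)| := by
  unfold l1Norm
  push_cast
  exact Finset.sum_congr rfl fun i _ => by rw [Nat.cast_natAbs, Int.cast_abs]

/-- `|y|₁ ≥ 1` for `y ≠ 0`. [folklore] -/
theorem one_le_l1Norm {y : Site d} (hy : y ≠ 0) : 1 ≤ l1Norm y := by
  obtain ⟨i, hi⟩ := Function.ne_iff.1 hy
  have h1 : 1 ≤ (y i).natAbs := Int.natAbs_pos.2 hi
  exact h1.trans (Finset.single_le_sum (f := fun j => (y j).natAbs) (fun j _ => Nat.zero_le _) (Finset.mem_univ i))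

/-- `|y|₂ ≤ |y|₁`. [folklore] -/
theorem euclidNorm_le_l1Norm (y : Site d) : euclidNorm y ≤ l1Norm y := by
  rw [euclidNorm, cast_l1Norm, Real.sqrt_le_iff]
  refine ⟨Finset.sum_nonneg fun i _ => abs_nonneg _, ?_⟩
  have habs : ∀ i, ((y i : ℤ) : ℝ) ^ 2 = |((y i : ℤ) : ℝ)| ^ 2 := fun i => (sq_abs _).symm
  simp_rw [habs]
  rw [sq, Finset.sum_mul]
  refine Finset.sum_le_sum fun i _ => ?_
  rw [sq]
  exact mul_le_mul_of_nonneg_left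
    (Finset.single_le_sum (f := fun j => |((y j : ℤ) : ℝ)|) (fun j _ => abs_nonneg _) (Finset.mem_univ i))
    (abs_nonneg _)

/-- `⟦y⟧ = |y|₂ ∨ 1 ≤ |y|₁` for `y ≠ 0`. [folklore] -/
theorem jnorm_le_l1Norm {y : Site d} (hy : y ≠ 0) : jnorm y ≤ l1Norm y :=
  max_le (euclidNorm_le_l1Norm y) (by exact_mod_cast one_le_l1Norm hy)

/-! ### The algebraically decaying couplings: symmetry, nearest neighbours, `|J| < ∞` -/

/-- `J_{x,y} = J_{y,x}`. [cite: Panis2023Triviality, §1.2.1 (J_{x,y} = C₀|x-y|₁^{-d-α})] -/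
theorem algebraicCoupling_symm (C₀ α : ℝ) (x y : Site d) :
    algebraicCoupling d C₀ α x y = algebraicCoupling d C₀ α y x := by
  unfold algebraicCoupling
  rw [l1Norm_sub_comm]
  by_cases h : x = y
  · subst h; rfl
  · rw [if_neg h, if_neg (Ne.symm h)]

/-- **`J_{x,y} = C₀` on nearest neighbours** (`|x-y|₁ = 1`). [cite: Panis2023Triviality, §1.2.1 (J_{x,y} = C₀|x-y|₁^{-d-α})] -/
theorem algebraicCoupling_eq_of_adj (C₀ α : ℝ) {x y : Site d} (h : (zdGraph d).Adj x y) :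
    algebraicCoupling d C₀ α x y = C₀ := by
  unfold algebraicCoupling
  rw [if_neg ((zdGraph d).ne_of_adj h), l1Norm_sub_eq_one_of_adj h, Nat.cast_one, Real.one_rpow, mul_one]

/-- **`J_{0,y} ≤ C₀ ⟦y⟧^{-(d+α)}`** for `C₀ ≥ 0`, `α ≥ 0`. [folklore] -/
theorem algebraicCoupling_zero_le {C₀ α : ℝ} (hC₀ : 0 ≤ C₀) (hα : 0 ≤ α) (y : Site d) :
    algebraicCoupling d C₀ α 0 y ≤ C₀ * jnorm y ^ (-((d : ℝ) + α)) := by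
  unfold algebraicCoupling
  split_ifs with h
  · exact mul_nonneg hC₀ (Real.rpow_nonneg (jnorm_pos y).le _)
  · rw [zero_sub, l1Norm_neg]
    refine mul_le_mul_of_nonneg_left ?_ hC₀
    exact Real.rpow_le_rpow_of_nonpos (jnorm_pos y) (jnorm_le_l1Norm (Ne.symm h))
      (by have : (0 : ℝ) ≤ d := Nat.cast_nonneg d; linarith)

/-- **`|J| < ∞`** (assumption (A2) for the algebraically decaying couplings): `y ↦ J_{0,y}` is summable
for `α > 0`, `C₀ ≥ 0`. [cite: Panis2023Triviality, §1.2.1 ((A2) locally finite: |J| < ∞)] -/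
theorem summable_algebraicCoupling_zero {C₀ α : ℝ} (hC₀ : 0 ≤ C₀) (hα : 0 < α) :
    Summable fun y : Site d => algebraicCoupling d C₀ α 0 y :=
  Summable.of_nonneg_of_le (fun y => algebraicCoupling_nonneg hC₀ α 0 y)
    (fun y => algebraicCoupling_zero_le hC₀ hα.le y)
    ((summable_jnorm_rpow_neg (by linarith : (d : ℝ) < d + α)).mul_left C₀)

/-- **Row sums are bounded by `|J| := ∑_{y ∈ ℤ^d} J_{0,y}`** (for a translation-invariant `J`,
Panis's `|J| := sup_x ∑_y J_{x,y}` of (A2) is this sum): `∑_{y∈Λ} J_{x,y} ≤ |J|` for every finite `Λ`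
and every `x` (translation invariance and `J ≥ 0` summable). [cite: Panis2023Triviality, §1.2.1 ((A2) |J| := sup_x ∑_y J_{x,y}, (A3))] -/
theorem sum_algebraicCoupling_le_tsum {C₀ α : ℝ} (hC₀ : 0 ≤ C₀) (hα : 0 < α)
    (Λ : Finset (Site d)) (x : Site d) :
    ∑ y ∈ Λ, algebraicCoupling d C₀ α x y ≤ ∑' y, algebraicCoupling d C₀ α 0 y := by
  have h1 : ∀ y, algebraicCoupling d C₀ α x y = algebraicCoupling d C₀ α 0 (y - x) := by
    intro y
    have h := algebraicCoupling_add C₀ α x 0 (y - x)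
    rw [zero_add, sub_add_cancel] at h
    exact h
  have h2 : ∑ y ∈ Λ, algebraicCoupling d C₀ α 0 (y - x) =
      ∑ z ∈ Λ.map (Equiv.subRight x).toEmbedding, algebraicCoupling d C₀ α 0 z := by
    rw [Finset.sum_map]
    rfl
  simp_rw [h1]
  rw [h2]
  exact (summable_algebraicCoupling_zero hC₀ hα).sum_le_tsum _ fun z _ => algebraicCoupling_nonneg hC₀ α 0 z

/-- **`|J| ≥ C₀ > 0`** for `d ≥ 1` (the term `y = e₀`). [cite: Panis2023Triviality, §1.2.1 ((A2))] -/
theorem le_tsum_algebraicCoupling (hd : 1 ≤ d) {C₀ α : ℝ} (hC₀ : 0 ≤ C₀) (hα : 0 < α) :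
    C₀ ≤ ∑' y, algebraicCoupling d C₀ α 0 y := by
  set e : Site d := Pi.single (⟨0, hd⟩ : Fin d) 1 with he
  have hadj : (zdGraph d).Adj 0 e := (zdGraph_adj_iff 0 e).2 ⟨⟨0, hd⟩, Or.inl (by rw [he, zero_add])⟩
  calc C₀ = algebraicCoupling d C₀ α 0 e := (algebraicCoupling_eq_of_adj C₀ α hadj).symm
    _ ≤ ∑' y, algebraicCoupling d C₀ α 0 y :=
        (summable_algebraicCoupling_zero hC₀ hα).le_tsum e fun z _ => algebraicCoupling_nonneg hC₀ α 0 z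

/-! ### `β_c ∈ [ |J|⁻¹, 4/C₀ ]` -/

/-- **Peierls: `m*(β) ≥ ½` for `βC₀ ≥ 4`**, hence `4/C₀ ∈ {β > 0 | m*(β) > 0}` (`d ≥ 2`).
[cite: Panis2023Triviality, §1.2.1 (β_c < ∞, after Peierls 1936)] -/
theorem four_div_mem (hd : 2 ≤ d) {C₀ α : ℝ} (hC₀ : 0 < C₀) :
    4 / C₀ ∈ {β : ℝ | 0 < β ∧ 0 < magnetization (algebraicCoupling d C₀ α) β} := by
  refine ⟨by positivity, lt_of_lt_of_le (by norm_num : (0 : ℝ) < 1 / 2) ?_⟩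
  exact half_le_magnetization hd (algebraicCoupling_nonneg hC₀.le α) (algebraicCoupling_add C₀ α) hC₀
    (fun x y hxy => (algebraicCoupling_eq_of_adj C₀ α hxy).ge) (by rw [div_mul_cancel₀ _ hC₀.ne'])

/-- **Fisher: every `β > 0` with `m*(β) > 0` has `β ≥ |J|⁻¹`.**
[cite: Panis2023Triviality, §1.2.1 (β_c ≥ |J|⁻¹, after Fisher 1967)] -/
theorem inv_tsum_le_of_mem (hd : 1 ≤ d) {C₀ α : ℝ} (hC₀ : 0 < C₀) (hα : 0 < α) {β : ℝ}
    (hβ : β ∈ {β : ℝ | 0 < β ∧ 0 < magnetization (algebraicCoupling d C₀ α) β}) :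
    (∑' y, algebraicCoupling d C₀ α 0 y)⁻¹ ≤ β := by
  have hN : 0 < ∑' y, algebraicCoupling d C₀ α 0 y := lt_of_lt_of_le hC₀ (le_tsum_algebraicCoupling hd hC₀.le hα)
  have h1 : 1 ≤ β * ∑' y, algebraicCoupling d C₀ α 0 y :=
    one_le_mul_of_magnetization_pos (algebraicCoupling d C₀ α) β hβ.1.le (algebraicCoupling_nonneg hC₀.le α)
      (algebraicCoupling_symm C₀ α)
      (fun L x _ => sum_algebraicCoupling_le_tsum hC₀.le hα (box d L) x) hβ.2
  rw [inv_le_iff_one_le_mul₀ hN]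
  linarith

/-- **`β_c ≥ |J|⁻¹`** (the printed Fisher bound) for `J_{x,y} = C₀|x-y|₁^{-d-α}`, `d ≥ 2`.
[cite: Panis2023Triviality, §1.2.1 (β_c ≥ |J|⁻¹, after Fisher 1967)] -/
theorem inv_tsum_le_criticalBeta (hd : 2 ≤ d) {C₀ α : ℝ} (hC₀ : 0 < C₀) (hα : 0 < α) :
    (∑' y, algebraicCoupling d C₀ α 0 y)⁻¹ ≤ LongRangeIsing.criticalBeta (algebraicCoupling d C₀ α) :=
  le_csInf ⟨_, four_div_mem hd hC₀⟩ fun _ hb => inv_tsum_le_of_mem (by omega) hC₀ hα hb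

/-- **`β_c ≤ 4/C₀ < ∞`** (Peierls) for `J_{x,y} = C₀|x-y|₁^{-d-α}`, `d ≥ 2`.
[cite: Panis2023Triviality, §1.2.1 (β_c < ∞, after Peierls 1936)] -/
theorem criticalBeta_le (hd : 2 ≤ d) {C₀ α : ℝ} (hC₀ : 0 < C₀) :
    LongRangeIsing.criticalBeta (algebraicCoupling d C₀ α) ≤ 4 / C₀ :=
  csInf_le ⟨0, fun _ hb => hb.1.le⟩ (four_div_mem hd hC₀)

end LongRangeIsing

open LongRangeIsing

/-- **Discharge of the named fact `panis_criticalBeta_pos`** (Panis 2023, §1.2.1: "`β_c := inf{β > 0,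
m*(β) > 0} ∈ (0,∞)`. The above assumptions guarantee [Fisher 1967] that `β_c > 0` (in fact
`β_c ≥ |J|⁻¹`)"): for `d ≥ 2` and `J_{x,y} = C₀|x-y|₁^{-d-α}`, `C₀, α > 0`, `0 < β_c`, because the
set `{β > 0 | m*(β) > 0}` contains `4/C₀` (Peierls) and lies above `|J|⁻¹ ≥ 0` with `|J| ≥ C₀ > 0`
(Fisher). [cite: Panis2023Triviality, §1.2.1 (β_c ∈ (0,∞))] -/
theorem panis_criticalBeta_pos_holds : panis_criticalBeta_pos := by
  intro d hd C₀ α hC₀ hα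
  have hN : 0 < ∑' y, algebraicCoupling d C₀ α 0 y :=
    lt_of_lt_of_le hC₀ (le_tsum_algebraicCoupling (by omega) hC₀.le hα)
  exact lt_of_lt_of_le (inv_pos.2 hN) (inv_tsum_le_criticalBeta hd hC₀ hα)

end Literature.Barriers.CriticalPhenomena
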